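/-
Copyright (c) 2026. All rights reserved.
Released under Apache 2.0 license as described in the file LICENSE.
Authors: abc-iut cell, statement-typer seat abc-iut-L4-t3 (wave 1).
-/
import Mathlib.Combinatorics.Quiver.Basic
import Mathlib.CategoryTheory.Functor.Category
import HarnessLib

/-!
# [AbsTopIII] Definition 5.4 (iii), (v), (vii): the oriented graphs `Γ⃗^log`, `Γ⃗^⋉`, `Γ⃗^⋊`, `Γ⃗^×` of the log-Frobenius operation

S. Mochizuki, *Topics in absolute anabelian geometry III: global reconstruction algorithms*,
J. Math. Sci. Univ. Tokyo 22 (2015) 939–1156 [MochizukiAbsTopIII2015]; locators `p.N` = pages of the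
author's manuscript (`paper:url-5493eb38cbb7`; journal pagination not held), read on the page: Def 5.4 (iii)
p. 126, (v) pp. 127–128, (vii) p. 128; Rmk 5.4.1 p. 129.

The COMBINATORIAL SKELETON of the local log-Frobenius operation, as REAL (finite) definitions:

* Def 5.4 (iii), nonarchimedean: the commutative diagram
  `𝒪^×_k̄ ↪ k̄^× ↪ k̄` (space-link) over `k~ →(id) k~ ↪ (k̄^×)^pf` (post-log on the left), with the vertical
  shell-arrow `𝒪^×_k̄ → k~` and `k̄^× → (k̄^×)^pf`, "determines an oriented graph `Γ⃗^log_non`"; `Γ⃗^⋉_non`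
  (remove the upper right-hand arrow `↪ k̄`), `Γ⃗^⋊_non` (remove the lower left-hand arrow `k~ →(id)`),
  `Γ⃗^×_non` (their intersection); the *post-log* vertex, the *pre-log* vertices, the *space-link* vertex, the
  *shell-arrow*.
* Def 5.4 (v), archimedean: `k~ →(id) k~ →(shell) k^× ↪ k`, with `Γ⃗^⋉_arc`, `Γ⃗^⋊_arc`, `Γ⃗^×_arc` likewise.
* Def 5.4 (vii): for each vertex `ν`, the functor `Λ_ν` = identity at a pre-log vertex, = the log-Frobenius
  functor `log` at the post-log vertex (`frobeniusTwist`).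

The OBJECTS at the vertices (the monoids `𝒪^×_k̄, k̄^×, …`, the log-shells) and the functors `λ⊞_{v,ν}`, natural
transformations `ι⊞_{v,ε}` of Def 5.4 (iv), (vi), (vii) live in the sibling interface files (they need the
categories `𝒩⊞_v`, `Th•_T[Z]`); the log-shell SETS are in `LogShells.lean`. Rmk 5.4.1 ("the diagrams of
Def 5.4 (iii), (v) cannot be extended to global number fields": the local logarithms do not induce a map from the
units of a number field to the number field) is recorded here as the design reason why these graphs are indexed
by a single valuation `v`. Refereed pre-IUT anabelian geometry; nothing here bears on [IUTchIII] Cor. 3.12.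
-/

set_option autoImplicit false

universe v u

namespace Literature.AnabelianGeometry.AbsoluteAnabelian

/-! ## Def 5.4 (iii): the nonarchimedean graph `Γ⃗^log_non` -/

/-- the six vertices of `Γ⃗^log_non`: `𝒪^×_k̄` (`units`), `k̄^×` (`mult`), the space-link vertex `k̄` (`spaceLink`),
the post-log vertex `k~` (`postLog`), the target `k~` of the shell-arrow (`shellCod`), and `(k̄^×)^pf` (`perf`).
[cite: MochizukiAbsTopIII2015, Def 5.4 (iii) p. 126] -/
inductive NonarchVertex : Type
  | units | mult | spaceLink | postLog | shellCod | perf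
  deriving DecidableEq

/-- the six arrows of `Γ⃗^log_non`: `𝒪^×_k̄ ↪ k̄^×`, `k̄^× ↪ k̄` (into the space-link vertex), the shell-arrow
`𝒪^×_k̄ → k~`, `k̄^× → (k̄^×)^pf`, the post-log arrow `k~ →(id) k~`, and `k~ ↪ (k̄^×)^pf`.
[cite: MochizukiAbsTopIII2015, Def 5.4 (iii) p. 126] -/
inductive NonarchEdge : NonarchVertex → NonarchVertex → Type
  | unitsToMult : NonarchEdge .units .mult
  | multToSpaceLink : NonarchEdge .mult .spaceLink
  | shell : NonarchEdge .units .shellCod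
  | multToPerf : NonarchEdge .mult .perf
  | postLogId : NonarchEdge .postLog .shellCod
  | shellCodToPerf : NonarchEdge .shellCod .perf

/-- `Γ⃗^log_non` as a quiver. [cite: MochizukiAbsTopIII2015, Def 5.4 (iii) p. 126] -/
instance NonarchVertex.instQuiver : Quiver NonarchVertex := ⟨NonarchEdge⟩

namespace NonarchVertex

/-- the post-log vertex ("the lower left-hand vertex, i.e. the first `k~`").
[cite: MochizukiAbsTopIII2015, Def 5.4 (iii) p. 126] -/
def IsPostLog (ν : NonarchVertex) : Prop := ν = postLog

/-- the pre-log vertices: all the other vertices. [cite: MochizukiAbsTopIII2015, Def 5.4 (iii) p. 126] -/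
def IsPreLog (ν : NonarchVertex) : Prop := ν ≠ postLog

/-- the space-link vertex ("the upper right-hand vertex, i.e. `k̄`"). [cite: MochizukiAbsTopIII2015, Def 5.4 (iii) p. 126] -/
def IsSpaceLink (ν : NonarchVertex) : Prop := ν = spaceLink

/-- decidability of "is the post-log vertex". [cite: MochizukiAbsTopIII2015, Def 5.4 (iii) p. 126] -/
instance (ν : NonarchVertex) : Decidable ν.IsPostLog := inferInstanceAs (Decidable (ν = postLog))

/-- decidability of "is a pre-log vertex". [cite: MochizukiAbsTopIII2015, Def 5.4 (iii) p. 126] -/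
instance (ν : NonarchVertex) : Decidable ν.IsPreLog := inferInstanceAs (Decidable (ν ≠ postLog))

end NonarchVertex

namespace NonarchEdge

/-- membership in `Γ⃗^⋉_non`: every arrow except the upper right-hand arrow `k̄^× ↪ k̄` (the diagram that "may be
considered either in `TS` or in `TS⊞`"). [cite: MochizukiAbsTopIII2015, Def 5.4 (iii) p. 126] -/
def InLeft : {a b : NonarchVertex} → NonarchEdge a b → Prop
  | _, _, multToSpaceLink => False
  | _, _, _ => True

/-- membership in `Γ⃗^⋊_non`: every arrow except the lower left-hand (post-log) arrow `k~ →(id) k~`.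
[cite: MochizukiAbsTopIII2015, Def 5.4 (iii) p. 126] -/
def InRight : {a b : NonarchVertex} → NonarchEdge a b → Prop
  | _, _, postLogId => False
  | _, _, _ => True

/-- membership in `Γ⃗^×_non := Γ⃗^⋉_non ∩ Γ⃗^⋊_non`. [cite: MochizukiAbsTopIII2015, Def 5.4 (iii) p. 126] -/
def InCore {a b : NonarchVertex} (e : NonarchEdge a b) : Prop := e.InLeft ∧ e.InRight

/-- the shell-arrow is "the left-hand vertical arrow" `𝒪^×_k̄ → k~`. [cite: MochizukiAbsTopIII2015, Def 5.4 (iii) p. 126] -/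
def IsShellArrow : {a b : NonarchVertex} → NonarchEdge a b → Prop
  | _, _, shell => True
  | _, _, _ => False

/-- the shell-arrow lies in `Γ⃗^×_non` (it is the arrow along which the log-shell `ℐ` is formed, Cor 5.10).
[cite: MochizukiAbsTopIII2015, Def 5.4 (iii) p. 126] -/
theorem inCore_shell : (shell).InCore := ⟨trivial, trivial⟩

/-- `Γ⃗^×_non` contains `𝒪^× ↪ k̄^×`, `k̄^× → (k̄^×)^pf`, `k~ ↪ (k̄^×)^pf` (and the shell-arrow) …
[cite: MochizukiAbsTopIII2015, Def 5.4 (iii) p. 126] -/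
theorem inCore_of_ne : (unitsToMult).InCore ∧ (multToPerf).InCore ∧ (shellCodToPerf).InCore :=
  ⟨⟨trivial, trivial⟩, ⟨trivial, trivial⟩, ⟨trivial, trivial⟩⟩

/-- … and neither the space-link arrow `k̄^× ↪ k̄` nor the post-log arrow `k~ →(id) k~`.
[cite: MochizukiAbsTopIII2015, Def 5.4 (iii) p. 126] -/
theorem not_inCore : ¬ (multToSpaceLink).InCore ∧ ¬ (postLogId).InCore :=
  ⟨fun h => h.1, fun h => h.2⟩

end NonarchEdge

/-- the terminal vertex of the nonarchimedean shell-arrow (where the `•`-shell-container structures of Cor 5.10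
(i), (iv) live for `v ∈ V(F_mod)^non`). [cite: MochizukiAbsTopIII2015, Def 5.4 (iii) p. 126] -/
def NonarchVertex.shellTerminal : NonarchVertex := .shellCod

/-! ## Def 5.4 (v): the archimedean graph `Γ⃗^log_arc` -/

/-- the four vertices of `Γ⃗^log_arc`: the post-log `k~` (`postLog`), the pre-log `k~` (`pre`), `k^×` (`mult`),
the space-link `k` (`spaceLink`). [cite: MochizukiAbsTopIII2015, Def 5.4 (v) p. 127] -/
inductive ArchVertex : Type
  | postLog | pre | mult | spaceLink
  deriving DecidableEq

/-- the three arrows `k~ →(id) k~ →(shell) k^× ↪ k`. [cite: MochizukiAbsTopIII2015, Def 5.4 (v) p. 127] -/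
inductive ArchEdge : ArchVertex → ArchVertex → Type
  | postLogId : ArchEdge .postLog .pre
  | shell : ArchEdge .pre .mult
  | multToSpaceLink : ArchEdge .mult .spaceLink

/-- `Γ⃗^log_arc` as a quiver. [cite: MochizukiAbsTopIII2015, Def 5.4 (v) p. 127] -/
instance ArchVertex.instQuiver : Quiver ArchVertex := ⟨ArchEdge⟩

namespace ArchVertex

/-- the post-log vertex ("the first `k~`"). [cite: MochizukiAbsTopIII2015, Def 5.4 (v) p. 127] -/
def IsPostLog (ν : ArchVertex) : Prop := ν = postLog

/-- the pre-log vertices. [cite: MochizukiAbsTopIII2015, Def 5.4 (v) p. 127] -/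
def IsPreLog (ν : ArchVertex) : Prop := ν ≠ postLog

/-- the space-link vertex `k`. [cite: MochizukiAbsTopIII2015, Def 5.4 (v) p. 127] -/
def IsSpaceLink (ν : ArchVertex) : Prop := ν = spaceLink

/-- decidability of "is the post-log vertex". [cite: MochizukiAbsTopIII2015, Def 5.4 (v) p. 127] -/
instance (ν : ArchVertex) : Decidable ν.IsPostLog := inferInstanceAs (Decidable (ν = postLog))

/-- decidability of "is a pre-log vertex". [cite: MochizukiAbsTopIII2015, Def 5.4 (v) p. 127] -/
instance (ν : ArchVertex) : Decidable ν.IsPreLog := inferInstanceAs (Decidable (ν ≠ postLog))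

/-- the initial vertex of the archimedean shell-arrow `k~ ↠ k^×` (where the `•`-shell-container structures of
Cor 5.10 (i), (iv) live for `v ∈ V(F_mod)^arc`). [cite: MochizukiAbsTopIII2015, Def 5.4 (v) p. 128] -/
def shellInitial : ArchVertex := .pre

end ArchVertex

namespace ArchEdge

/-- `Γ⃗^⋉_arc`: remove the arrow `↪ k` on the right. [cite: MochizukiAbsTopIII2015, Def 5.4 (v) p. 127] -/
def InLeft : {a b : ArchVertex} → ArchEdge a b → Prop
  | _, _, multToSpaceLink => False
  | _, _, _ => True

/-- `Γ⃗^⋊_arc`: remove the arrow `k~ →(id)` on the left. [cite: MochizukiAbsTopIII2015, Def 5.4 (v) p. 127] -/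
def InRight : {a b : ArchVertex} → ArchEdge a b → Prop
  | _, _, postLogId => False
  | _, _, _ => True

/-- `Γ⃗^×_arc := Γ⃗^⋉_arc ∩ Γ⃗^⋊_arc` (the single shell-arrow `k~ ↠ k^×`). [cite: MochizukiAbsTopIII2015, Def 5.4 (v) p. 127] -/
def InCore {a b : ArchVertex} (e : ArchEdge a b) : Prop := e.InLeft ∧ e.InRight

/-- the archimedean shell-arrow `k~ ↠ k^×`. [cite: MochizukiAbsTopIII2015, Def 5.4 (v) p. 128] -/
def IsShellArrow : {a b : ArchVertex} → ArchEdge a b → Prop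
  | _, _, shell => True
  | _, _, _ => False

/-- `Γ⃗^×_arc` consists of the shell-arrow alone. [cite: MochizukiAbsTopIII2015, Def 5.4 (v) p. 127] -/
theorem inCore_iff {a b : ArchVertex} (e : ArchEdge a b) : e.InCore ↔ e.IsShellArrow := by
  cases e <;> simp [InCore, InLeft, InRight, IsShellArrow]

end ArchEdge

/-! ## Def 5.4 (vii): the twist `Λ_ν` -/

section Twist

open CategoryTheory

variable {X : Type u} [Category.{v} X]

/-- `Λ_ν` (Def 5.4 (vii)): "for each pre-log vertex `ν` of `Γ⃗^log_v` we take `Λ_ν` to be the identity functor on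
`Th•_T[Z]`; for the post-log vertex `ν` … the log-Frobenius functor `log•_{T,T}`", as a functor-valued function
of the Boolean "is `ν` the post-log vertex". [cite: MochizukiAbsTopIII2015, Def 5.4 (vii) p. 128] -/
def frobeniusTwist (log : X ⥤ X) (isPostLog : Bool) : X ⥤ X := if isPostLog then log else 𝟭 X

/-- `Λ_ν` at a pre-log vertex is the identity. [cite: MochizukiAbsTopIII2015, Def 5.4 (vii) p. 128] -/
@[simp] theorem frobeniusTwist_false (log : X ⥤ X) : frobeniusTwist log false = 𝟭 X := rfl

/-- `Λ_ν` at the post-log vertex is `log`. [cite: MochizukiAbsTopIII2015, Def 5.4 (vii) p. 128] -/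
@[simp] theorem frobeniusTwist_true (log : X ⥤ X) : frobeniusTwist log true = log := rfl

/-- `Λ_ν` for a vertex of `Γ⃗^log_non`. [cite: MochizukiAbsTopIII2015, Def 5.4 (vii) p. 128] -/
def NonarchVertex.twist (log : X ⥤ X) (ν : NonarchVertex) : X ⥤ X := frobeniusTwist log (decide ν.IsPostLog)

/-- `Λ_ν` for a vertex of `Γ⃗^log_arc`. [cite: MochizukiAbsTopIII2015, Def 5.4 (vii) p. 128] -/
def ArchVertex.twist (log : X ⥤ X) (ν : ArchVertex) : X ⥤ X := frobeniusTwist log (decide ν.IsPostLog)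

end Twist

end Literature.AnabelianGeometry.AbsoluteAnabelian
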